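import Summits.QuantumFields.YangMills.Theorems.UnitScaleTiltProp7ConjFrameTransport
import Summits.QuantumFields.YangMills.Theorems.UnitScaleTiltProp7CovariantWeitzenbock
import Summits.QuantumFields.YangMills.Theorems.UnitScaleTiltProp7PinnedBiharmonicAgmonInterp
import HarnessLib

/-!
# Route `UnitScaleTilt`, crux K1 «MinimiserStabilityRegPr» (stmt-QuantumFields-19200), route-R E′ path (α′), S2 ∕ (E1-b) at the CURVED background — (D2′-cov) FILE 1:
# COVARIANT AGMON LETTERS — Hilbert–Schmidt bounds for the commutators `[Δ_U, w]`, `[D_U, w]` with a SCALAR multiplier `w` against a reference weight `ω`, and their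
# weighted `ℓ²` sums (the covariant twins of ✓ `Prop7PinnedBiharmonicAgmonLetters` §2–§4; the scalar weight rows are consumed BY NAME)

Cell `ym3-torus`, extra width seat `ym-routeR-w6` (gen 6); LOCATE `ym-routeR-w6/LOCATE-PCOV2-routeRw6g6.md` v1.1 §1 (D2′-cov) ∕ §4 (energy bricks are holonomy-blind: the weight
is scalar, no frame).  THEOREMS ONLY (0 `def`, 0 `sorry`); `--supports stmt-QuantumFields-19200`, count-neutral.  YM₃ on T³ is a ladder rung (R3), not the Clay problem; nothing
here claims a stub, the crux, d = 4 or the mass gap.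

WHAT IS PROVED (ns `…Theorems.Prop7CovAgmonLetters`; torus `Site P i`, `T = torusT P i`, unitary `U`, `hs X = Σ‖X_jk‖²`, scalar `w, ω, θ : Site → ℝ` acting by `•`).
* §1 `hs_smul` (`hs(r•X) = r²·hs X`), `hs_sum_le` (`hs(Σ_{i∈s}Y_i) ≤ |s|·Σ hs(Y_i)`), `hs_covDstar_eq` (`hs(D*_μF(x)) = hs(D_μF(x − e_μ))`, unitary `U`).
* §2 ★ `hs_weighted_comm_le` — POINTWISE: under the multiplier rows `θ|w(x±e_μ) − w(x)| ≤ αω(x)`, `θ|w(x+e_μ) + w(x−e_μ) − 2w(x)| ≤ βω(x)`: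
  `θ(x)²·hs(Δ_U(w•F)(x) − w(x)•Δ_UF(x)) ≤ 3d·Σ_μ[α²ω²hs(D_μF(x)) + α²ω²hs(D_μF(x−e_μ)) + β²ω²hs(F(x))]` (✓ `Prop7ConjFrameTransport.divB_covD_smul_fun` + §1).
* §3 ★★ `sum_hs_weighted_comm_le` — SUMMED with the weight rows `a ≤ 1∕2`: `Σ_x θ²hs([Δ_U,w]F) ≤ 10d·α²·Σ_xΣ_μ ω(x)²hs(D_μF(x)) + 3d²β²·Σ_x ω²hs(F)` (shifted weights by
  ✓ `Prop7PinnedBiharmonicAgmonLetters.weight_unshift_le`).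
HONEST SCOPE.  Letters only; the weighted interpolation for the covariant gradient is FILE 2 (`…CovAgmonInterp`), the core screening estimate (D2′-cov) FILE 3.

References: T. Bałaban, CMP 96 (1984) 223–250 [Balaban1984PropagatorsII] ((1.9) p.226); CMP 99 (1985) 389–434 [Balaban1985BackgroundPropagators] ((3.3), (3.8) pp.390–392);
S. Agmon, Princeton Math. Notes 29 (1982) (method).
-/

set_option autoImplicit false

noncomputable section

open scoped BigOperators Matrix.Norms.L2Operator Matrix

namespace Summit.QuantumFields.YangMills.Theorems.Prop7CovAgmonLetters

open Literature.MathematicalPhysics.QuantumFieldTheory.Balaban1983to89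
open LatticeFieldCalculus (shiftEquiv)
open B10StarCount (shift_unshift unshift_shift)
open Summit.QuantumFields.YangMills.Theorems.Prop7FlatCoercivity (sum_shift)
open B9Eq39Adjoint (R covD covDstar divB sum_sum_covD_mul)
open B9TorusCalculus (torusT torusT_apply torusT_symm_apply)
open Summit.QuantumFields.YangMills.Theorems.Prop7CovariantCoercivity (sum_norm_sq_R conjTranspose_covD re_trace_conjTranspose_mul_self re_trace_mul_comm)
open Summit.QuantumFields.YangMills.Theorems.Prop7ConjFrameTransport (covD_smul_fun divB_covD_smul_fun)
open Summit.QuantumFields.YangMills.Theorems.Prop7PinnedBiharmonicAgmonLetters (weight_shift_le weight_unshift_le)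
open Summit.QuantumFields.YangMills.Theorems.Prop7PinnedBiharmonicAgmonInterp (sq_weight_rows)

variable {P : Params} {i : ℕ} {N : ℕ}

/-! ## §1 Hilbert–Schmidt bookkeeping: real scalars, finite sums, the backward derivative -/

/-- `hs(r•X) = r²·hs X` for a real scalar. [folklore] -/
theorem hs_smul (r : ℝ) (X : Matrix (Fin N) (Fin N) ℂ) :
    ∑ j : Fin N, ∑ k : Fin N, ‖(r • X) j k‖ ^ 2 = r ^ 2 * ∑ j : Fin N, ∑ k : Fin N, ‖X j k‖ ^ 2 := by
  rw [Finset.mul_sum]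
  refine Finset.sum_congr rfl fun j _ => ?_
  rw [Finset.mul_sum]
  refine Finset.sum_congr rfl fun k _ => ?_
  rw [Matrix.smul_apply, norm_smul, mul_pow, Real.norm_eq_abs, sq_abs]

/-- `hs(Σ_{i∈s} Y_i) ≤ |s|·Σ_{i∈s} hs(Y_i)` (Cauchy–Schwarz entrywise). [folklore] -/
theorem hs_sum_le {ι : Type*} (s : Finset ι) (Y : ι → Matrix (Fin N) (Fin N) ℂ) :
    ∑ j : Fin N, ∑ k : Fin N, ‖(∑ t ∈ s, Y t) j k‖ ^ 2 ≤ s.card * ∑ t ∈ s, ∑ j : Fin N, ∑ k : Fin N, ‖(Y t) j k‖ ^ 2 := by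
  have hjk : ∀ j k, ‖(∑ t ∈ s, Y t) j k‖ ^ 2 ≤ s.card * ∑ t ∈ s, ‖(Y t) j k‖ ^ 2 := by
    intro j k
    rw [Matrix.sum_apply]
    have h1 : ‖∑ t ∈ s, Y t j k‖ ≤ ∑ t ∈ s, ‖Y t j k‖ := norm_sum_le _ _
    have h2 : (∑ t ∈ s, ‖Y t j k‖) ^ 2 ≤ s.card * ∑ t ∈ s, ‖Y t j k‖ ^ 2 := by
      have h := Finset.sum_mul_sq_le_sq_mul_sq s (fun _ => (1 : ℝ)) (fun t => ‖Y t j k‖)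
      simp only [one_mul, one_pow, Finset.sum_const, nsmul_eq_mul, mul_one] at h
      exact h
    exact (pow_le_pow_left₀ (norm_nonneg _) h1 2).trans h2
  calc ∑ j : Fin N, ∑ k : Fin N, ‖(∑ t ∈ s, Y t) j k‖ ^ 2 ≤ ∑ j : Fin N, ∑ k : Fin N, (s.card * ∑ t ∈ s, ‖(Y t) j k‖ ^ 2) :=
        Finset.sum_le_sum fun j _ => Finset.sum_le_sum fun k _ => hjk j k
    _ = ∑ j : Fin N, ∑ t ∈ s, ∑ k : Fin N, (s.card : ℝ) * ‖(Y t) j k‖ ^ 2 := by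
        refine Finset.sum_congr rfl fun j _ => ?_
        rw [Finset.sum_comm]
        exact Finset.sum_congr rfl fun k _ => Finset.mul_sum _ _ _
    _ = ∑ t ∈ s, ∑ j : Fin N, ∑ k : Fin N, (s.card : ℝ) * ‖(Y t) j k‖ ^ 2 := Finset.sum_comm
    _ = s.card * ∑ t ∈ s, ∑ j : Fin N, ∑ k : Fin N, ‖(Y t) j k‖ ^ 2 := by simp only [Finset.mul_sum]

/-- `hs(A + B + C) ≤ 3(hs A + hs B + hs C)`. [folklore] -/
theorem hs_add₃_le (A B C : Matrix (Fin N) (Fin N) ℂ) :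
    ∑ j : Fin N, ∑ k : Fin N, ‖(A + B + C) j k‖ ^ 2
      ≤ 3 * (∑ j : Fin N, ∑ k : Fin N, ‖A j k‖ ^ 2 + ∑ j : Fin N, ∑ k : Fin N, ‖B j k‖ ^ 2 + ∑ j : Fin N, ∑ k : Fin N, ‖C j k‖ ^ 2) := by
  rw [mul_add, mul_add, Finset.mul_sum, Finset.mul_sum, Finset.mul_sum, ← Finset.sum_add_distrib, ← Finset.sum_add_distrib]
  refine Finset.sum_le_sum fun j _ => ?_
  rw [Finset.mul_sum, Finset.mul_sum, Finset.mul_sum, ← Finset.sum_add_distrib, ← Finset.sum_add_distrib]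
  refine Finset.sum_le_sum fun k _ => ?_
  simp only [Matrix.add_apply]
  have h1 : ‖A j k + B j k + C j k‖ ≤ ‖A j k‖ + ‖B j k‖ + ‖C j k‖ := norm_add₃_le
  have h0 : 0 ≤ ‖A j k + B j k + C j k‖ := norm_nonneg _
  nlinarith [h1, h0, norm_nonneg (A j k), norm_nonneg (B j k), norm_nonneg (C j k),
    sq_nonneg (‖A j k‖ - ‖B j k‖), sq_nonneg (‖A j k‖ - ‖C j k‖), sq_nonneg (‖B j k‖ - ‖C j k‖)]

/-- `hs(−X) = hs X`. [folklore] -/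
theorem hs_neg (X : Matrix (Fin N) (Fin N) ℂ) :
    ∑ j : Fin N, ∑ k : Fin N, ‖(-X) j k‖ ^ 2 = ∑ j : Fin N, ∑ k : Fin N, ‖X j k‖ ^ 2 := by
  simp only [Matrix.neg_apply, norm_neg]

section Unitary

variable {U : Fin P.d → Site P i → (Matrix (Fin N) (Fin N) ℂ)ˣ}

/-- **THE BACKWARD DERIVATIVE IS THE TRANSPORTED FORWARD ONE**: `D*_μF(x) = −R(U_μ(x−e_μ))⁻¹ (D_μF)(x−e_μ)`. [cite: Balaban1985BackgroundPropagators, (3.8) p.392] -/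
theorem covDstar_eq_neg_R_covD (μ : Fin P.d) (F : Site P i → Matrix (Fin N) (Fin N) ℂ) (x : Site P i) :
    covDstar (torusT P i) U μ F x = -(R (U μ ((torusT P i μ).symm x))⁻¹ (covD (torusT P i) U μ F ((torusT P i μ).symm x))) := by
  have hy : torusT P i μ ((torusT P i μ).symm x) = x := Equiv.apply_symm_apply _ _
  simp only [covDstar, covD, hy, B9Eq39Adjoint.R_sub, B9Eq39Adjoint.R_inv_R]
  abel

/-- `hs(D*_μF(x)) = hs(D_μF(x − e_μ))` at a unitary background. [cite: Balaban1985BackgroundPropagators, (3.8) p.392] -/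
theorem hs_covDstar_eq (hU : ∀ ν x, (U ν x : Matrix (Fin N) (Fin N) ℂ) ∈ unitary (Matrix (Fin N) (Fin N) ℂ))
    (μ : Fin P.d) (F : Site P i → Matrix (Fin N) (Fin N) ℂ) (x : Site P i) :
    ∑ j : Fin N, ∑ k : Fin N, ‖(covDstar (torusT P i) U μ F x) j k‖ ^ 2
      = ∑ j : Fin N, ∑ k : Fin N, ‖(covD (torusT P i) U μ F ((torusT P i μ).symm x)) j k‖ ^ 2 := by
  rw [covDstar_eq_neg_R_covD, hs_neg, sum_norm_sq_R (Summit.QuantumFields.YangMills.Theorems.Prop7CovariantCoercivity.inv_mem_unitary (hU μ _))]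

omit U in
/-- **LEIBNIZ WITH THE WEIGHT AT THE SOURCE**: `D_U(w•F)(x,μ) = w(x)•D_UF(x,μ) + (w(x+e_μ) − w(x))•R(U_μ(x))F(x+e_μ)`. [cite: Balaban1985BackgroundPropagators, (3.3) p.390] -/
theorem covD_smul_fun_src (V : Fin P.d → Site P i → (Matrix (Fin N) (Fin N) ℂ)ˣ) (w : Site P i → ℝ) (F : Site P i → Matrix (Fin N) (Fin N) ℂ)
    (μ : Fin P.d) (x : Site P i) :
    covD (torusT P i) V μ (fun z => w z • F z) x
      = w x • covD (torusT P i) V μ F x + (w (torusT P i μ x) - w x) • R (V μ x) (F (torusT P i μ x)) := by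
  simp only [covD, B9Eq39Adjoint.R_smul, smul_sub, sub_smul]
  abel

end Unitary

/-! ## §2 ★ The pointwise commutator bound -/

/-- ★ **POINTWISE HS BOUND FOR `[Δ_U, w]`**: if a scalar multiplier `w` has first differences `θ|w(x±e_μ) − w(x)| ≤ αω(x)` and second differences
`θ|w(x+e_μ) + w(x−e_μ) − 2w(x)| ≤ βω(x)` against the weight `ω` (read through a test weight `θ ≥ 0`), then
`θ(x)²·hs(Δ_U(w•F)(x) − w(x)•Δ_UF(x)) ≤ 3d·Σ_μ[α²ω(x)²hs(D*_μF(x)) + α²ω(x)²hs(D_μF(x)) + β²ω(x)²hs(F(x))]` (any units `U`).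
[cite: Balaban1984PropagatorsII, (1.9) p.226] -/
theorem hs_weighted_comm_le (U : Fin P.d → Site P i → (Matrix (Fin N) (Fin N) ℂ)ˣ) (ω w θ : Site P i → ℝ)
    (F : Site P i → Matrix (Fin N) (Fin N) ℂ) {α β : ℝ} (hθ : ∀ x, 0 ≤ θ x)
    (hw₁ : ∀ x μ, θ x * |w (x.shift μ) - w x| ≤ α * ω x ∧ θ x * |w (x.unshift μ) - w x| ≤ α * ω x)
    (hw₂ : ∀ x μ, θ x * |w (x.shift μ) + w (x.unshift μ) - 2 * w x| ≤ β * ω x) (x : Site P i) :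
    θ x ^ 2 * ∑ j : Fin N, ∑ k : Fin N,
        ‖(divB (torusT P i) U (fun μ => covD (torusT P i) U μ (fun z => w z • F z)) x - w x • divB (torusT P i) U (fun μ => covD (torusT P i) U μ F) x) j k‖ ^ 2
      ≤ 3 * P.d * ∑ μ : Fin P.d, (α ^ 2 * ω x ^ 2 * ∑ j : Fin N, ∑ k : Fin N, ‖(covDstar (torusT P i) U μ F x) j k‖ ^ 2
          + α ^ 2 * ω x ^ 2 * ∑ j : Fin N, ∑ k : Fin N, ‖(covD (torusT P i) U μ F x) j k‖ ^ 2
          + β ^ 2 * ω x ^ 2 * ∑ j : Fin N, ∑ k : Fin N, ‖(F x) j k‖ ^ 2) := by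
  classical
  -- the commutator as a sum over directions of three weighted terms
  have hcomm : divB (torusT P i) U (fun μ => covD (torusT P i) U μ (fun z => w z • F z)) x - w x • divB (torusT P i) U (fun μ => covD (torusT P i) U μ F) x
      = ∑ μ : Fin P.d, ((w x - w (x.unshift μ)) • covDstar (torusT P i) U μ F x
          + (-(w (x.shift μ) - w x)) • covD (torusT P i) U μ F x
          + (-((w (x.shift μ) - w x) - (w x - w (x.unshift μ)))) • F x) := by
    rw [divB_covD_smul_fun, add_sub_cancel_left]
    refine Finset.sum_congr rfl fun μ _ => ?_
    simp only [torusT_apply, torusT_symm_apply, neg_smul]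
    abel
  rw [hcomm]
  -- `θ²·hs(Σ_μ Y_μ) ≤ θ²·d·Σ_μ hs(Y_μ) ≤ θ²·d·Σ_μ 3(hs + hs + hs)`
  have h1 := hs_sum_le (Finset.univ : Finset (Fin P.d)) fun μ => (w x - w (x.unshift μ)) • covDstar (torusT P i) U μ F x
      + (-(w (x.shift μ) - w x)) • covD (torusT P i) U μ F x + (-((w (x.shift μ) - w x) - (w x - w (x.unshift μ)))) • F x
  rw [Finset.card_univ, Fintype.card_fin] at h1
  have hθ2 : 0 ≤ θ x ^ 2 := sq_nonneg _
  have hd : (0 : ℝ) ≤ P.d := Nat.cast_nonneg _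
  -- per direction: `θ²·hs(Y_μ) ≤ 3(α²ω²hs* + α²ω²hs + β²ω²hsF)`
  suffices hμ : ∀ μ : Fin P.d, θ x ^ 2 * ∑ j : Fin N, ∑ k : Fin N,
      ‖((w x - w (x.unshift μ)) • covDstar (torusT P i) U μ F x + (-(w (x.shift μ) - w x)) • covD (torusT P i) U μ F x
        + (-((w (x.shift μ) - w x) - (w x - w (x.unshift μ)))) • F x) j k‖ ^ 2
      ≤ 3 * (α ^ 2 * ω x ^ 2 * ∑ j : Fin N, ∑ k : Fin N, ‖(covDstar (torusT P i) U μ F x) j k‖ ^ 2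
          + α ^ 2 * ω x ^ 2 * ∑ j : Fin N, ∑ k : Fin N, ‖(covD (torusT P i) U μ F x) j k‖ ^ 2
          + β ^ 2 * ω x ^ 2 * ∑ j : Fin N, ∑ k : Fin N, ‖(F x) j k‖ ^ 2) by
    calc _ ≤ θ x ^ 2 * ((P.d : ℝ) * ∑ μ : Fin P.d, ∑ j : Fin N, ∑ k : Fin N,
          ‖((w x - w (x.unshift μ)) • covDstar (torusT P i) U μ F x + (-(w (x.shift μ) - w x)) • covD (torusT P i) U μ F x
            + (-((w (x.shift μ) - w x) - (w x - w (x.unshift μ)))) • F x) j k‖ ^ 2) := mul_le_mul_of_nonneg_left h1 hθ2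
      _ = (P.d : ℝ) * ∑ μ : Fin P.d, θ x ^ 2 * ∑ j : Fin N, ∑ k : Fin N,
          ‖((w x - w (x.unshift μ)) • covDstar (torusT P i) U μ F x + (-(w (x.shift μ) - w x)) • covD (torusT P i) U μ F x
            + (-((w (x.shift μ) - w x) - (w x - w (x.unshift μ)))) • F x) j k‖ ^ 2 := by
          rw [Finset.mul_sum, Finset.mul_sum, Finset.mul_sum]
          exact Finset.sum_congr rfl fun μ _ => by ring
      _ ≤ (P.d : ℝ) * ∑ μ : Fin P.d, 3 * (α ^ 2 * ω x ^ 2 * ∑ j : Fin N, ∑ k : Fin N, ‖(covDstar (torusT P i) U μ F x) j k‖ ^ 2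
          + α ^ 2 * ω x ^ 2 * ∑ j : Fin N, ∑ k : Fin N, ‖(covD (torusT P i) U μ F x) j k‖ ^ 2
          + β ^ 2 * ω x ^ 2 * ∑ j : Fin N, ∑ k : Fin N, ‖(F x) j k‖ ^ 2) :=
          mul_le_mul_of_nonneg_left (Finset.sum_le_sum fun μ _ => hμ μ) hd
      _ = _ := by rw [← Finset.mul_sum]; ring
  intro μ
  have h3 := hs_add₃_le ((w x - w (x.unshift μ)) • covDstar (torusT P i) U μ F x) ((-(w (x.shift μ) - w x)) • covD (torusT P i) U μ F x)
    ((-((w (x.shift μ) - w x) - (w x - w (x.unshift μ)))) • F x)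
  rw [hs_smul, hs_smul, hs_smul] at h3
  have r1 : θ x ^ 2 * (w x - w (x.unshift μ)) ^ 2 ≤ α ^ 2 * ω x ^ 2 := by
    have h := (hw₁ x μ).2
    have e : θ x ^ 2 * (w x - w (x.unshift μ)) ^ 2 = (θ x * |w (x.unshift μ) - w x|) ^ 2 := by
      rw [mul_pow, sq_abs]; ring
    rw [e, ← mul_pow]
    exact pow_le_pow_left₀ (mul_nonneg (hθ x) (abs_nonneg _)) h 2
  have r2 : θ x ^ 2 * (-(w (x.shift μ) - w x)) ^ 2 ≤ α ^ 2 * ω x ^ 2 := by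
    have h := (hw₁ x μ).1
    have e : θ x ^ 2 * (-(w (x.shift μ) - w x)) ^ 2 = (θ x * |w (x.shift μ) - w x|) ^ 2 := by
      rw [mul_pow, sq_abs]; ring
    rw [e, ← mul_pow]
    exact pow_le_pow_left₀ (mul_nonneg (hθ x) (abs_nonneg _)) h 2
  have r3 : θ x ^ 2 * (-((w (x.shift μ) - w x) - (w x - w (x.unshift μ)))) ^ 2 ≤ β ^ 2 * ω x ^ 2 := by
    have h := hw₂ x μ
    have e : θ x ^ 2 * (-((w (x.shift μ) - w x) - (w x - w (x.unshift μ)))) ^ 2 = (θ x * |w (x.shift μ) + w (x.unshift μ) - 2 * w x|) ^ 2 := by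
      rw [mul_pow, sq_abs]; ring
    rw [e, ← mul_pow]
    exact pow_le_pow_left₀ (mul_nonneg (hθ x) (abs_nonneg _)) h 2
  have n1 : 0 ≤ ∑ j : Fin N, ∑ k : Fin N, ‖(covDstar (torusT P i) U μ F x) j k‖ ^ 2 := Finset.sum_nonneg fun _ _ => Finset.sum_nonneg fun _ _ => sq_nonneg _
  have n2 : 0 ≤ ∑ j : Fin N, ∑ k : Fin N, ‖(covD (torusT P i) U μ F x) j k‖ ^ 2 := Finset.sum_nonneg fun _ _ => Finset.sum_nonneg fun _ _ => sq_nonneg _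
  have n3 : 0 ≤ ∑ j : Fin N, ∑ k : Fin N, ‖(F x) j k‖ ^ 2 := Finset.sum_nonneg fun _ _ => Finset.sum_nonneg fun _ _ => sq_nonneg _
  have m1 := mul_le_mul_of_nonneg_right r1 n1
  have m2 := mul_le_mul_of_nonneg_right r2 n2
  have m3 := mul_le_mul_of_nonneg_right r3 n3
  nlinarith [mul_le_mul_of_nonneg_left h3 hθ2, m1, m2, m3]

/-! ## §3 ★★ The summed commutator bound -/

section Summed

variable {U : Fin P.d → Site P i → (Matrix (Fin N) (Fin N) ℂ)ˣ}

/-- ★★ **`ℓ²` HS BOUND FOR `[Δ_U, w]`** (unitary background, weight rows `a ≤ 1∕2`):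
`Σ_x θ²hs(Δ_U(w•F) − w•Δ_UF) ≤ 10d·α²·Σ_xΣ_μ ω(x)²hs(D_μF(x)) + 3d²β²·Σ_x ω(x)²hs(F(x))`. [cite: Balaban1984PropagatorsII, (1.9) p.226] -/
theorem sum_hs_weighted_comm_le (hU : ∀ ν x, (U ν x : Matrix (Fin N) (Fin N) ℂ) ∈ unitary (Matrix (Fin N) (Fin N) ℂ))
    (ω w θ : Site P i → ℝ) (F : Site P i → Matrix (Fin N) (Fin N) ℂ) {a α β : ℝ} (ha : a ≤ 1 / 2) (hω₀ : ∀ x, 0 < ω x)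
    (hω₁ : ∀ x μ, |ω (x.shift μ) - ω x| ≤ a * ω x ∧ |ω (x.unshift μ) - ω x| ≤ a * ω x) (hθ : ∀ x, 0 ≤ θ x)
    (hw₁ : ∀ x μ, θ x * |w (x.shift μ) - w x| ≤ α * ω x ∧ θ x * |w (x.unshift μ) - w x| ≤ α * ω x)
    (hw₂ : ∀ x μ, θ x * |w (x.shift μ) + w (x.unshift μ) - 2 * w x| ≤ β * ω x) :
    ∑ x : Site P i, θ x ^ 2 * ∑ j : Fin N, ∑ k : Fin N,
        ‖(divB (torusT P i) U (fun μ => covD (torusT P i) U μ (fun z => w z • F z)) x - w x • divB (torusT P i) U (fun μ => covD (torusT P i) U μ F) x) j k‖ ^ 2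
      ≤ 10 * P.d * α ^ 2 * ∑ x : Site P i, ∑ μ : Fin P.d, ω x ^ 2 * ∑ j : Fin N, ∑ k : Fin N, ‖(covD (torusT P i) U μ F x) j k‖ ^ 2
        + 3 * (P.d : ℝ) ^ 2 * β ^ 2 * ∑ x : Site P i, ω x ^ 2 * ∑ j : Fin N, ∑ k : Fin N, ‖(F x) j k‖ ^ 2 := by
  have hd : (0 : ℝ) ≤ P.d := Nat.cast_nonneg _
  -- sum the pointwise bound
  have h1 := Finset.sum_le_sum fun x (_ : x ∈ (Finset.univ : Finset (Site P i))) => hs_weighted_comm_le U ω w θ F hθ hw₁ hw₂ x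
  refine h1.trans ?_
  -- name the three global sums
  set G2 := ∑ x : Site P i, ∑ μ : Fin P.d, ω x ^ 2 * ∑ j : Fin N, ∑ k : Fin N, ‖(covD (torusT P i) U μ F x) j k‖ ^ 2 with hG2
  set N2 := ∑ x : Site P i, ω x ^ 2 * ∑ j : Fin N, ∑ k : Fin N, ‖(F x) j k‖ ^ 2 with hN2
  -- the backward-derivative sum is a shifted forward-derivative sum with the weight at the target: `≤ (9/4)·G2`
  have hback : ∑ x : Site P i, ∑ μ : Fin P.d, ω x ^ 2 * ∑ j : Fin N, ∑ k : Fin N, ‖(covDstar (torusT P i) U μ F x) j k‖ ^ 2 ≤ 9 / 4 * G2 := by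
    have e1 : ∑ x : Site P i, ∑ μ : Fin P.d, ω x ^ 2 * ∑ j : Fin N, ∑ k : Fin N, ‖(covDstar (torusT P i) U μ F x) j k‖ ^ 2
        = ∑ μ : Fin P.d, ∑ x : Site P i, ω (x.shift μ) ^ 2 * ∑ j : Fin N, ∑ k : Fin N, ‖(covD (torusT P i) U μ F x) j k‖ ^ 2 := by
      rw [Finset.sum_comm]
      refine Finset.sum_congr rfl fun μ _ => ?_
      simp only [hs_covDstar_eq hU, torusT_symm_apply]
      rw [← sum_shift μ (fun y => ω y ^ 2 * ∑ j : Fin N, ∑ k : Fin N, ‖(covD (torusT P i) U μ F (y.unshift μ)) j k‖ ^ 2)]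
      refine Finset.sum_congr rfl fun x _ => ?_
      rw [unshift_shift]
    rw [e1, hG2, Finset.mul_sum, Finset.sum_comm]
    refine Finset.sum_le_sum fun x _ => ?_
    rw [Finset.mul_sum]
    refine Finset.sum_le_sum fun μ _ => ?_
    have hs' := weight_shift_le ω ha hω₀ hω₁ x μ
    have h0 : 0 ≤ ∑ j : Fin N, ∑ k : Fin N, ‖(covD (torusT P i) U μ F x) j k‖ ^ 2 := Finset.sum_nonneg fun _ _ => Finset.sum_nonneg fun _ _ => sq_nonneg _
    have hsq : ω (x.shift μ) ^ 2 ≤ 9 / 4 * ω x ^ 2 := by nlinarith [hω₀ (x.shift μ), hω₀ x]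
    nlinarith [mul_le_mul_of_nonneg_right hsq h0]
  -- split and bound
  have hsplit : ∑ x : Site P i, 3 * P.d * ∑ μ : Fin P.d, (α ^ 2 * ω x ^ 2 * ∑ j : Fin N, ∑ k : Fin N, ‖(covDstar (torusT P i) U μ F x) j k‖ ^ 2
          + α ^ 2 * ω x ^ 2 * ∑ j : Fin N, ∑ k : Fin N, ‖(covD (torusT P i) U μ F x) j k‖ ^ 2
          + β ^ 2 * ω x ^ 2 * ∑ j : Fin N, ∑ k : Fin N, ‖(F x) j k‖ ^ 2)
      = 3 * P.d * (α ^ 2 * ∑ x : Site P i, ∑ μ : Fin P.d, ω x ^ 2 * ∑ j : Fin N, ∑ k : Fin N, ‖(covDstar (torusT P i) U μ F x) j k‖ ^ 2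
          + α ^ 2 * G2 + P.d * (β ^ 2 * N2)) := by
    rw [hG2, hN2, ← Finset.mul_sum]
    congr 1
    simp only [Finset.sum_add_distrib, Finset.sum_const, Finset.card_univ, Fintype.card_fin, nsmul_eq_mul, Finset.mul_sum]
    congr 1
    · congr 1 <;> exact Finset.sum_congr rfl fun x _ => Finset.sum_congr rfl fun μ _ => by ring
    · exact Finset.sum_congr rfl fun x _ => by ring
  rw [hsplit]
  have hG0 : 0 ≤ G2 := Finset.sum_nonneg fun _ _ => Finset.sum_nonneg fun _ _ => by positivity
  have hN0 : 0 ≤ N2 := Finset.sum_nonneg fun _ _ => by positivity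
  have hα : 0 ≤ α ^ 2 := sq_nonneg _
  nlinarith [mul_le_mul_of_nonneg_left hback hα, mul_nonneg hd (mul_nonneg hα hG0), mul_nonneg hd hG0]

end Summed

end Summit.QuantumFields.YangMills.Theorems.Prop7CovAgmonLetters

end
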